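import Mathlib
import Summits.ValiantsHypothesis.ValiantsHypothesis.Theorems.NewtonUnitEquationsDissociatedUniformQuasiPoly
import Summits.ValiantsHypothesis.ValiantsHypothesis.Theorems.NewtonUnitEquationsDissociatedUniformStubGoodProduct

/-!
# Crux `NewtonUnitEquations.DissociatedUniform` (stmt-ValiantsHypothesis-5905), line `greedy-basis-shadow` —
# stub `stub_zerosDepth` (ALL frames: a greedy word has a good product)

Setting: a frame `A : Fin m → Finset ℕ²` with coefficient polynomials `f i j` (structural ZEROS allowed), a chart
height `h b = ε · Xf b + λ · Yf b` injective on the box `piFinset A`, and a word `a` that is lex-greedy for `h`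
(`a ∈ QuasiPoly.gE (piFinset A) (col f) h`).  Conclusion: `a` is ALIVE in some product `i` (no coefficient of a
letter of `a` vanishes in product `i`) in which at most `k - 1` coordinates carry an alive letter strictly above
`a j` — i.e. `a` differs from the top word of product `i`'s alive box in `≤ k - 1` coordinates.  This is the depth
half of the zero-pattern analysis (lead c6's Conjecture Z'), replacing the torus-only `stub_torusDepth`.

Proof.  Greedy gives a linear functional `ψ` on `ℂ^k` with `ψ (col f a) ≠ 0` killing the span of the higher
columns (`Submodule.exists_dual_map_eq_bot_of_notMem`); write `ψ u = ∑ i, ψc i * u i`.  On the UP-BOX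
`Π_j U j`, `U j = {l ∈ A j | h-letter (a j) ≤ h-letter l}`, every word other than `a` is strictly higher (heights
are additive over letters; injectivity), so `ψ` kills its column while `a` survives: the rank-one functions
`b ↦ ψc i * ∏ j, coeff (b j) (f i j)` of the products that are not identically zero on the up-box sum to
`ψ (col f a) · 𝟙_a`.  LEMMA Z (`stub_goodProduct`, tree file `…StubGoodProduct.lean`) returns a product alive at
`a` with a letter of `U j ∖ {a j}` alive in at most `|S| - 1 ≤ k - 1` coordinates. [folklore glue]
-/

open scoped BigOperators

-- Sub = Summit single-conjunct layout: the duplicated namespace component is mandated by the tree.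
set_option linter.dupNamespace false

namespace Summit.ValiantsHypothesis.ValiantsHypothesis.Theorems.NewtonUnitEquationsDissociatedUniform

/-- **Good product for every frame** (registered stub `stub_zerosDepth` of line `greedy-basis-shadow`).  A word
that is lex-greedy for an injective chart height is alive in some product `i` in which at most `k - 1`
coordinates carry an alive letter strictly above its own letter (Lemma Z `stub_goodProduct` applied to the
annihilator equation on the up-box of the word). [folklore glue] -/
theorem stub_zerosDepth (k m : ℕ) (A : Fin m → Finset (Fin 2 →₀ ℕ)) (f : Fin k → Fin m → MvPolynomial (Fin 2) ℂ)
    (ε lam : ℝ) (a : Fin m → (Fin 2 →₀ ℕ))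
    (hinj : Set.InjOn (fun b : Fin m → (Fin 2 →₀ ℕ) => ε * QuasiPoly.Xf b + lam * QuasiPoly.Yf b) (Fintype.piFinset A))
    (ha : a ∈ QuasiPoly.gE (Fintype.piFinset A) (QuasiPoly.col f)
      (fun b : Fin m → (Fin 2 →₀ ℕ) => ε * QuasiPoly.Xf b + lam * QuasiPoly.Yf b)) :
    ∃ i : Fin k, (∀ j, (f i j).coeff (a j) ≠ 0) ∧
      (Finset.univ.filter fun j => ∃ l ∈ A j, (f i j).coeff l ≠ 0 ∧
        ε * ((a j 0 : ℕ) : ℝ) + lam * ((a j 1 : ℕ) : ℝ) < ε * ((l 0 : ℕ) : ℝ) + lam * ((l 1 : ℕ) : ℝ)).card + 1 ≤ k := by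
  classical
  -- letter heights; the height is additive over the letters of a word
  set lhf : (Fin 2 →₀ ℕ) → ℝ := fun l => ε * ((l 0 : ℕ) : ℝ) + lam * ((l 1 : ℕ) : ℝ) with hlhf
  have hadd : ∀ b : Fin m → (Fin 2 →₀ ℕ), ε * QuasiPoly.Xf b + lam * QuasiPoly.Yf b = ∑ j, lhf (b j) := by
    intro b
    simp only [QuasiPoly.Xf, QuasiPoly.Yf, Finsupp.coe_finsetSum, Finset.sum_apply, Nat.cast_sum,
      Finset.mul_sum, Finset.sum_add_distrib, hlhf]
  obtain ⟨haA, hnot⟩ := ha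
  have haA' : ∀ j, a j ∈ A j := Fintype.mem_piFinset.mp haA
  -- a linear functional separating `col f a` from the span of the higher columns
  obtain ⟨ψ, hψa, hψW⟩ := Submodule.exists_dual_map_eq_bot_of_notMem hnot inferInstance
  have hψkill : ∀ b ∈ Fintype.piFinset A,
      ε * QuasiPoly.Xf a + lam * QuasiPoly.Yf a < ε * QuasiPoly.Xf b + lam * QuasiPoly.Yf b →
      ψ (QuasiPoly.col f b) = 0 := by
    intro b hb hlt
    rw [← LinearMap.le_ker_iff_map] at hψW
    exact LinearMap.mem_ker.mp (hψW (Submodule.subset_span ⟨b, ⟨hb, hlt⟩, rfl⟩))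
  -- coordinates of `ψ`
  let ψc : Fin k → ℂ := fun i => ψ fun i' => if i = i' then 1 else 0
  have hψsum : ∀ u : Fin k → ℂ, ψ u = ∑ i, ψc i * u i := by
    intro u
    rw [LinearMap.pi_apply_eq_sum_univ ψ u]
    refine Finset.sum_congr rfl fun i _ => ?_
    rw [smul_eq_mul, mul_comm]
  -- the up-box of `a`
  set U : Fin m → Finset (Fin 2 →₀ ℕ) := fun j => (A j).filter fun l => lhf (a j) ≤ lhf l with hU
  have haU : ∀ j, a j ∈ U j := fun j => Finset.mem_filter.mpr ⟨haA' j, le_rfl⟩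
  have hUA : ∀ j, U j ⊆ A j := fun j => Finset.filter_subset _ _
  -- the coefficient functions and the terms that do not vanish on the up-box
  set v : Fin k → Fin m → (Fin 2 →₀ ℕ) → ℂ := fun i j l => (f i j).coeff l with hv
  set S : Finset (Fin k) := Finset.univ.filter fun i => ψc i ≠ 0 ∧ ∀ j, ∃ l ∈ U j, v i j l ≠ 0 with hS
  -- the annihilator equation on the up-box
  have heq : ∀ b ∈ Fintype.piFinset U,
      ∑ i ∈ S, ψc i * ∏ j, v i j (b j) = if b = a then ψ (QuasiPoly.col f a) else 0 := by
    intro b hb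
    have hbU : ∀ j, b j ∈ U j := Fintype.mem_piFinset.mp hb
    have hbA : b ∈ Fintype.piFinset A := Fintype.mem_piFinset.mpr fun j => hUA j (hbU j)
    have hfull : ∑ i, ψc i * ∏ j, v i j (b j) = ψ (QuasiPoly.col f b) := by
      rw [hψsum]
      rfl
    have hvan : ∀ i ∈ (Finset.univ : Finset (Fin k)), i ∉ S → ψc i * ∏ j, v i j (b j) = 0 := by
      intro i _ hi
      have hi' : ¬ (ψc i ≠ 0 ∧ ∀ j, ∃ l ∈ U j, v i j l ≠ 0) := fun h =>
        hi (Finset.mem_filter.mpr ⟨Finset.mem_univ _, h⟩)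
      rw [not_and_or] at hi'
      rcases hi' with h1 | h2
      · rw [not_ne_iff.mp h1, zero_mul]
      · push Not at h2
        obtain ⟨j, hj⟩ := h2
        rw [Finset.prod_eq_zero (Finset.mem_univ j) (hj (b j) (hbU j)), mul_zero]
    have hSsum : ∑ i ∈ S, ψc i * ∏ j, v i j (b j) = ∑ i, ψc i * ∏ j, v i j (b j) :=
      Finset.sum_subset (Finset.subset_univ S) hvan
    rw [hSsum, hfull]
    by_cases hba : b = a
    · rw [if_pos hba, hba]
    · rw [if_neg hba]
      apply hψkill b hbA
      have hle : ε * QuasiPoly.Xf a + lam * QuasiPoly.Yf a ≤ ε * QuasiPoly.Xf b + lam * QuasiPoly.Yf b := by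
        rw [hadd a, hadd b]
        exact Finset.sum_le_sum fun j _ => (Finset.mem_filter.mp (hbU j)).2
      have hne : ε * QuasiPoly.Xf a + lam * QuasiPoly.Yf a ≠ ε * QuasiPoly.Xf b + lam * QuasiPoly.Yf b :=
        fun h => hba (hinj hbA haA h.symm)
      exact lt_of_le_of_ne hle hne
  -- Lemma Z
  have hx : ∀ i ∈ S, ψc i ≠ 0 := fun i hi => (Finset.mem_filter.mp hi).2.1
  have hvS : ∀ i ∈ S, ∀ j, ∃ l ∈ U j, v i j l ≠ 0 := fun i hi => (Finset.mem_filter.mp hi).2.2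
  obtain ⟨i, -, halive, hdepth⟩ := stub_goodProduct k S U a haU ψc v (ψ (QuasiPoly.col f a)) hψa hx hvS heq
  refine ⟨i, fun j => halive j, ?_⟩
  have hScard : S.card ≤ k := (Finset.card_le_univ S).trans (by simp)
  refine le_trans ?_ (hdepth.trans hScard)
  refine Nat.add_le_add_right (Finset.card_le_card fun j hj => ?_) 1
  rw [Finset.mem_filter] at hj ⊢
  obtain ⟨-, l, hlA, hvl, hlt⟩ := hj
  refine ⟨Finset.mem_univ _, l, Finset.mem_filter.mpr ⟨hlA, ?_⟩, ?_, hvl⟩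
  · simpa [hlhf] using hlt.le
  · rintro rfl
    exact lt_irrefl _ hlt

end Summit.ValiantsHypothesis.ValiantsHypothesis.Theorems.NewtonUnitEquationsDissociatedUniform
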